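import Mathlib
import Summits.ValiantsHypothesis.ValiantsHypothesis.Theorems.GrenetZeonTwoDimCoefficientsScalingThreeHalvesConditional
import Summits.ValiantsHypothesis.ValiantsHypothesis.Theorems.GrenetZeonTwoDimCoefficientsScalingIndexUpToCorankLt

/-!
# Crux `GrenetZeon.TwoDimCoefficients` (stmt-ValiantsHypothesis-8062) / rung `DualUnipotentThreeHalves` (stmt-24318):
# scaling-closure — THE RESIDUAL OF RECORD after the nineteenth hand: IC in the regime ⟹ the decl BY NAME

The honest residual of the Hessian route, as ONE hypothesis with a free regime constant `C₀` (this matters: garbage blocks that make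
index reduction expensive cost size, and a large `C₀` starves them — memo NINETEENTH-HAND.md §8):

  IC_reg(C₀): for every unipotent dual representation of `per_n` (`n ≥ 3`) with `C₀·m² < n³`, in pencil form `A = A₀(1 − N)` with
  `Nⁿ ≠ 0`, there is a linear subspace `U ≤ ℂ^{n×n}` of codimension `< n` on which the pencil is pointwise of nil-index `≤ n`
  (`N(u)ⁿ = 0` for all `u ∈ U`).

Given IC_reg(C₀), every representation satisfies `n³ ≤ max(4, C₀)·m²`: outside the regime trivially, at nil-index `≤ n` by
✓ `cube_le_two_mul_sq_of_index` (p835662), and otherwise by the unconditional ✓ `cube_le_four_mul_sq_of_indexLeOn_codim_lt`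
(p838058; per-genericity supplied by the SHARP ✓ PG(k < n), p837946).  NO statement about the permanent remains in the hypothesis.

* ★★ `threeHalves_of_indexCostInRegime` — IC_reg(C₀) ⟹ `∀ n ≥ 3, DualUnipotentRepr n m → n³ ≤ max 4 C₀ · m²`;
* ★★ `dualUnipotentThreeHalves_of_indexCostInRegime` — IC_reg(C₀) ⟹ `Theses.GrenetZeon.DualUnipotentThreeHalves` BY NAME.

HONEST FRAMING: CONDITIONAL on IC_reg(C₀) for some `C₀` (open — the pure INDEX-COST question on the nilpotent matrix space of a
representation; heuristic cost of index-`n` reduction ≈ dim/n ≤ n, so the regime constant is what gives the margin).  Item 24318 is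
NOT closed; the stub `DualUnipotentBound`, crux 8062 and `VP ≠ VNP` remain open.

References: T. Mignon, N. Ressayre, Int. Math. Res. Not. 2004:79, Thm. 1.1 (via the tree); folklore.
-/

-- single-conjunct layout `Summits/ValiantsHypothesis/ValiantsHypothesis`: the duplicated namespace
-- component is mandated by the tree.
set_option linter.dupNamespace false
set_option autoImplicit false

noncomputable section

namespace Summit.ValiantsHypothesis.ValiantsHypothesis.Theorems.GrenetZeonTwoDimCoefficients.ScalingClosure

open MvPolynomial Matrix
open Literature.Computability.AlgebraicComplexity
open Literature.Algebra.Polynomial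
open Summit.ValiantsHypothesis.ValiantsHypothesis.Cruxes.TwoDimCoefficients.DimTwoCases

section IndexCostInRegime

/-- ★★ **IC_reg(C₀) ⟹ `n³ ≤ max(4, C₀)·m²` for every unipotent dual representation (`n ≥ 3`).**  HYPOTHESIS `hIC` (open, pure
index-cost IN THE REGIME `C₀ m² < n³`): a subspace of codimension `< n` on which the pencil is pointwise of nil-index `≤ n`.
[cite: MignonRessayre2004, Thm. 1.1 — via the tree; folklore] -/
theorem threeHalves_of_indexCostInRegime (C₀ : ℕ)
    (hIC : ∀ (n m : ℕ) (A B : AffMat n m) (A₀ P₀ : Matrix (Fin m) (Fin m) ℂ) (N : AffMat n m) (α β c : ℂ),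
      3 ≤ n → C₀ * m ^ 2 < n ^ 3 → IsAffine A → IsAffine B → c ≠ 0 → β ≠ 0 → A.det = MvPolynomial.C c →
      perPoly (Fin n) ℂ = MvPolynomial.C α * A.det + MvPolynomial.C β * (A.adjugate * B).trace →
      A₀ * P₀ = 1 → (∀ i j, (N i j).IsHomogeneous 1) → A = A₀.map MvPolynomial.C * (1 - N) → N ^ n ≠ 0 →
      ∃ U : Submodule ℂ (Fin n × Fin n → ℂ),
        (∀ u ∈ U, (N.map (MvPolynomial.eval u)) ^ n = 0) ∧ n ^ 2 < Module.finrank ℂ U + n) :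
    ∀ n : ℕ, 3 ≤ n → ∀ m : ℕ, DualUnipotentRepr n m → n ^ 3 ≤ max 4 C₀ * m ^ 2 := by
  intro n hn m hrep
  by_cases hreg : C₀ * m ^ 2 < n ^ 3
  · obtain ⟨α, β, c, A, B, hA, hB, hc, hdet, hper⟩ := hrep
    have hβ : β ≠ 0 := by
      intro hβ0
      apply perPoly_ne_C (n := n) (by omega) (α * c)
      rw [hper, hdet, hβ0, map_zero, zero_mul, add_zero, ← map_mul]
    obtain ⟨A₀, P₀, N, hP₀, hN, hAN⟩ := exists_pencilData A hA c hc hdet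
    have h4 : n ^ 3 ≤ 4 * m ^ 2 := by
      by_cases hNn : N ^ n = 0
      · obtain ⟨k, rfl⟩ : ∃ k, n = k + 3 := ⟨n - 3, by omega⟩
        have h := cube_le_two_mul_sq_of_index A B hA hB α β c hc hβ hdet hper A₀ P₀ hP₀ N hN hNn hAN
        omega
      · obtain ⟨U, hU, hUdim⟩ := hIC n m A B A₀ P₀ N α β c hn hreg hA hB hc hβ hdet hper hP₀ hN hAN hNn
        exact cube_le_four_mul_sq_of_indexLeOn_codim_lt hn A B hA hB α β c hc hβ hdet hper A₀ P₀ hP₀ N hN hAN U hU hUdim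
    exact h4.trans (Nat.mul_le_mul_right _ (le_max_left 4 C₀))
  · push Not at hreg
    exact hreg.trans (Nat.mul_le_mul_right _ (le_max_right 4 C₀))

/-- ★★ **IC_reg(C₀) ⟹ the route decl `DualUnipotentThreeHalves` (stmt-24318) BY NAME**, with `C = max 4 C₀`, `n₀ = 3`.  CONDITIONAL on
the pure index-cost-in-the-regime hypothesis (open). [cite: MignonRessayre2004, Thm. 1.1 — via the tree; folklore] -/
theorem dualUnipotentThreeHalves_of_indexCostInRegime (C₀ : ℕ)
    (hIC : ∀ (n m : ℕ) (A B : AffMat n m) (A₀ P₀ : Matrix (Fin m) (Fin m) ℂ) (N : AffMat n m) (α β c : ℂ),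
      3 ≤ n → C₀ * m ^ 2 < n ^ 3 → IsAffine A → IsAffine B → c ≠ 0 → β ≠ 0 → A.det = MvPolynomial.C c →
      perPoly (Fin n) ℂ = MvPolynomial.C α * A.det + MvPolynomial.C β * (A.adjugate * B).trace →
      A₀ * P₀ = 1 → (∀ i j, (N i j).IsHomogeneous 1) → A = A₀.map MvPolynomial.C * (1 - N) → N ^ n ≠ 0 →
      ∃ U : Submodule ℂ (Fin n × Fin n → ℂ),
        (∀ u ∈ U, (N.map (MvPolynomial.eval u)) ^ n = 0) ∧ n ^ 2 < Module.finrank ℂ U + n) :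
    Summit.ValiantsHypothesis.ValiantsHypothesis.Theses.GrenetZeon.DualUnipotentThreeHalves := by
  unfold Summit.ValiantsHypothesis.ValiantsHypothesis.Theses.GrenetZeon.DualUnipotentThreeHalves
  exact ⟨max 4 C₀, 3, fun n hn m hrep => threeHalves_of_indexCostInRegime C₀ hIC n hn m hrep⟩

end IndexCostInRegime

end Summit.ValiantsHypothesis.ValiantsHypothesis.Theorems.GrenetZeonTwoDimCoefficients.ScalingClosure

end
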